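import Literature.RepresentationTheory.KonnoKonno2007.JunctionVacuumSectionLevi
import Literature.Analysis.SegalBargmann.FockDualPairCompact
import HarnessLib

/-!
# `KAK` implementer data for a product of two groups on a block sum of carriers

The finite-dimensional bookkeeping that makes the Levi-family constructor
`JunctionVacuumSectionLevi.kakImplementerData_leviFamily` MULTIPLICATIVE IN THE GROUP: if `G₁` acts on the phase
space of `ℝ^{σ₁}` and `G₂` on that of `ℝ^{σ₂}`, each with Levi-family `KAK` inputs (compact part through
`μ₀ ∘ ιKᵢ`, `A`-part a family of dilations `Lᵢ` in a unitary frame `Uᵢ`, proper surjective word map), then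
`G₁ × G₂` acts on the phase space of `ℝ^{σ₁ ⊕ σ₂}` by the block sum `sumPhase`, and its Levi-family inputs are the
block sums: frame `blockU (U₁, U₂)`, dilations `sumLin (L₁ t₁) (L₂ t₂)`, compact part `blockU ∘ (ιK₁ × ιK₂)`, word map
= product of the word maps (proper and onto). The output is again `KAKImplementerData`, on `𝓢(ℝ^{σ₁ ⊕ σ₂})`, with
operators `μ₀(blockU(U₁,U₂))⁻¹ ∘ leviS (sumLin …) ∘ μ₀(blockU(U₁,U₂))` — NO tensor product of Schwartz operators is
formed. The case of a COMPACT second factor (`P₂ = PUnit`) is recorded separately.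

Intended use: the archimedean group of a unitary dual pair over a totally real field with several real places is
the product over the places of real dual pairs; at each place the data are those of `JunctionVacuumSection` (real
rank one, [KonnoKonno2007, §3.1]) or compact.

All statements are kernel-proved; no cited statement enters as a hypothesis.

References: G. B. Folland, Harmonic Analysis in Phase Space, Princeton UP 1989, §4.2 (4.24) p. 156, Prop. (4.39);
A. W. Knapp, Lie Groups Beyond an Introduction, 2nd ed., Birkhäuser 2002, Thm 7.39.
-/

noncomputable section

open MeasureTheory Complex SchwartzMap Matrix
open scoped InnerProductSpace ComplexConjugate Real

namespace Literature.RepresentationTheory.KonnoKonno2007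

open Literature.Analysis.SegalBargmann Literature.RepresentationTheory.HeisenbergGroup
open Literature.NumberTheory.Weil1964

variable {σ₁ σ₂ : Type*} [Fintype σ₁] [DecidableEq σ₁] [Fintype σ₂] [DecidableEq σ₂]

local notation "SR" σ => SchwartzMap (σ → ℝ) ℂ
local notation "PV" σ => (σ → ℝ) × (σ → ℝ)

/-! ## 1. Block sums of phase maps, unitary frames and dilations -/

section Blocks

/-- The block sum of two phase-space maps, acting on `ℝ^{σ₁ ⊕ σ₂} × ℝ^{σ₁ ⊕ σ₂}` blockwise. [folklore] -/
def sumPhase (γ₁ : PhaseMap σ₁) (γ₂ : PhaseMap σ₂) : PhaseMap (σ₁ ⊕ σ₂) := fun pq =>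
  (Sum.elim (γ₁ (pq.1 ∘ Sum.inl, pq.2 ∘ Sum.inl)).1 (γ₂ (pq.1 ∘ Sum.inr, pq.2 ∘ Sum.inr)).1,
    Sum.elim (γ₁ (pq.1 ∘ Sum.inl, pq.2 ∘ Sum.inl)).2 (γ₂ (pq.1 ∘ Sum.inr, pq.2 ∘ Sum.inr)).2)

omit [Fintype σ₁] [DecidableEq σ₁] [Fintype σ₂] [DecidableEq σ₂] in
/-- unfolding `sumPhase`. [folklore] -/
theorem sumPhase_apply (γ₁ : PhaseMap σ₁) (γ₂ : PhaseMap σ₂) (pq : PV (σ₁ ⊕ σ₂)) :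
    sumPhase γ₁ γ₂ pq =
      (Sum.elim (γ₁ (pq.1 ∘ Sum.inl, pq.2 ∘ Sum.inl)).1 (γ₂ (pq.1 ∘ Sum.inr, pq.2 ∘ Sum.inr)).1,
        Sum.elim (γ₁ (pq.1 ∘ Sum.inl, pq.2 ∘ Sum.inl)).2 (γ₂ (pq.1 ∘ Sum.inr, pq.2 ∘ Sum.inr)).2) := rfl

omit [Fintype σ₁] [DecidableEq σ₁] [Fintype σ₂] [DecidableEq σ₂] in
/-- `sumPhase` is functorial. [folklore] -/
theorem sumPhase_comp (γ₁ γ₁' : PhaseMap σ₁) (γ₂ γ₂' : PhaseMap σ₂) :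
    sumPhase (γ₁ ∘ γ₁') (γ₂ ∘ γ₂') = sumPhase γ₁ γ₂ ∘ sumPhase γ₁' γ₂' := by
  funext pq
  simp only [Function.comp_apply, sumPhase_apply, Sum.elim_comp_inl, Sum.elim_comp_inr, Prod.mk.eta]

omit [Fintype σ₁] [DecidableEq σ₁] [Fintype σ₂] [DecidableEq σ₂] in
/-- `id ⊞ id = id`. [folklore] -/
theorem sumPhase_id : sumPhase (id : PhaseMap σ₁) (id : PhaseMap σ₂) = id := by
  funext pq
  simp only [sumPhase_apply, id, Sum.elim_comp_inl_inr, Prod.mk.eta]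

/-- The block sum of two linear automorphisms of `ℝ^{σ₁}`, `ℝ^{σ₂}`. [folklore] -/
def sumLin (L₁ : (σ₁ → ℝ) ≃ₗ[ℝ] (σ₁ → ℝ)) (L₂ : (σ₂ → ℝ) ≃ₗ[ℝ] (σ₂ → ℝ)) :
    ((σ₁ ⊕ σ₂) → ℝ) ≃ₗ[ℝ] ((σ₁ ⊕ σ₂) → ℝ) :=
  (LinearEquiv.sumArrowLequivProdArrow σ₁ σ₂ ℝ ℝ).trans
    ((L₁.prodCongr L₂).trans (LinearEquiv.sumArrowLequivProdArrow σ₁ σ₂ ℝ ℝ).symm)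

omit [Fintype σ₁] [DecidableEq σ₁] [Fintype σ₂] [DecidableEq σ₂] in
/-- `(L₁ ⊞ L₂) x = (L₁ (x|σ₁), L₂ (x|σ₂))`. [folklore] -/
@[simp] theorem sumLin_apply (L₁ : (σ₁ → ℝ) ≃ₗ[ℝ] (σ₁ → ℝ)) (L₂ : (σ₂ → ℝ) ≃ₗ[ℝ] (σ₂ → ℝ))
    (x : (σ₁ ⊕ σ₂) → ℝ) : sumLin L₁ L₂ x = Sum.elim (L₁ (x ∘ Sum.inl)) (L₂ (x ∘ Sum.inr)) := by
  funext i
  rcases i with i | j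
  · simp [sumLin, LinearEquiv.sumArrowLequivProdArrow, Equiv.sumArrowEquivProdArrow]
  · simp [sumLin, LinearEquiv.sumArrowLequivProdArrow, Equiv.sumArrowEquivProdArrow]

omit [Fintype σ₁] [DecidableEq σ₁] [Fintype σ₂] [DecidableEq σ₂] in
/-- `(L₁ ⊞ L₂)⁻¹ = L₁⁻¹ ⊞ L₂⁻¹`. [folklore] -/
theorem sumLin_symm (L₁ : (σ₁ → ℝ) ≃ₗ[ℝ] (σ₁ → ℝ)) (L₂ : (σ₂ → ℝ) ≃ₗ[ℝ] (σ₂ → ℝ)) :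
    (sumLin L₁ L₂).symm = sumLin L₁.symm L₂.symm := rfl

omit [DecidableEq σ₁] [DecidableEq σ₂] in
/-- contragredience is blockwise. [folklore] -/
theorem sumLin_dotProduct {L₁ Ld₁ : (σ₁ → ℝ) ≃ₗ[ℝ] (σ₁ → ℝ)} {L₂ Ld₂ : (σ₂ → ℝ) ≃ₗ[ℝ] (σ₂ → ℝ)}
    (h₁ : ∀ x y : σ₁ → ℝ, L₁ x ⬝ᵥ Ld₁ y = x ⬝ᵥ y) (h₂ : ∀ x y : σ₂ → ℝ, L₂ x ⬝ᵥ Ld₂ y = x ⬝ᵥ y)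
    (x y : (σ₁ ⊕ σ₂) → ℝ) : sumLin L₁ L₂ x ⬝ᵥ sumLin Ld₁ Ld₂ y = x ⬝ᵥ y := by
  rw [sumLin_apply, sumLin_apply, sumElim_dotProduct_sumElim, h₁, h₂]
  conv_rhs => rw [← Sum.elim_comp_inl_inr x, ← Sum.elim_comp_inl_inr y, sumElim_dotProduct_sumElim]

omit [Fintype σ₁] [DecidableEq σ₁] [Fintype σ₂] [DecidableEq σ₂] in
/-- The Levi phase map of a block sum is the block sum of the Levi phase maps. [folklore] -/
theorem leviPhase_sumLin (L₁ Ld₁ : (σ₁ → ℝ) ≃ₗ[ℝ] (σ₁ → ℝ)) (L₂ Ld₂ : (σ₂ → ℝ) ≃ₗ[ℝ] (σ₂ → ℝ)) :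
    leviPhase (sumLin L₁ L₂) (sumLin Ld₁ Ld₂) = sumPhase (leviPhase L₁ Ld₁) (leviPhase L₂ Ld₂) := by
  funext pq
  simp only [leviPhase_apply, sumLin_apply, sumPhase_apply]

/-- `realify` of a block-diagonal unitary is the block sum. [folklore] -/
theorem realify_blockU (U₁ : Matrix.unitaryGroup σ₁ ℂ) (U₂ : Matrix.unitaryGroup σ₂ ℂ) :
    realify (blockU (U₁, U₂)) = sumPhase (realify U₁) (realify U₂) := by
  funext pq
  have hpt : ∀ (p q : (σ₁ ⊕ σ₂) → ℝ), phasePt p q =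
      Sum.elim (phasePt (p ∘ Sum.inl) (q ∘ Sum.inl)) (phasePt (p ∘ Sum.inr) (q ∘ Sum.inr)) := by
    intro p q
    funext k
    rcases k with k | k <;> rfl
  simp only [realify, coe_blockU, sumPhase_apply, hpt, Matrix.fromBlocks_mulVec, Sum.elim_comp_inl,
    Sum.elim_comp_inr, Matrix.zero_mulVec, add_zero, zero_add]
  refine Prod.ext ?_ ?_ <;> funext k <;> rcases k with k | k <;> rfl

/-- `realify 1 = id`. [folklore] -/
theorem realify_one {σ : Type*} [Fintype σ] [DecidableEq σ] (pq : PV σ) :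
    realify (1 : Matrix.unitaryGroup σ ℂ) pq = pq := by
  obtain ⟨p, q⟩ := pq
  simp only [realify, OneMemClass.coe_one, Matrix.one_mulVec]
  refine Prod.ext ?_ ?_ <;> funext k <;> simp [phasePt_apply]

omit [DecidableEq σ₁] [DecidableEq σ₂] in
/-- **Operator-norm continuity of block sums of dilations.** [folklore] -/
theorem continuous_sumLin_symm {X : Type*} [TopologicalSpace X] {L₁ : X → ((σ₁ → ℝ) ≃ₗ[ℝ] (σ₁ → ℝ))}
    {L₂ : X → ((σ₂ → ℝ) ≃ₗ[ℝ] (σ₂ → ℝ))}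
    (h₁ : Continuous fun t => (((L₁ t).symm.toContinuousLinearEquiv : (σ₁ → ℝ) ≃L[ℝ] (σ₁ → ℝ)) :
      (σ₁ → ℝ) →L[ℝ] (σ₁ → ℝ)))
    (h₂ : Continuous fun t => (((L₂ t).symm.toContinuousLinearEquiv : (σ₂ → ℝ) ≃L[ℝ] (σ₂ → ℝ)) :
      (σ₂ → ℝ) →L[ℝ] (σ₂ → ℝ))) :
    Continuous fun t => (((sumLin (L₁ t) (L₂ t)).symm.toContinuousLinearEquiv :
      ((σ₁ ⊕ σ₂) → ℝ) ≃L[ℝ] ((σ₁ ⊕ σ₂) → ℝ)) : ((σ₁ ⊕ σ₂) → ℝ) →L[ℝ] ((σ₁ ⊕ σ₂) → ℝ)) := by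
  let E : ((σ₁ ⊕ σ₂) → ℝ) ≃L[ℝ] (σ₁ → ℝ) × (σ₂ → ℝ) :=
    (LinearEquiv.sumArrowLequivProdArrow σ₁ σ₂ ℝ ℝ).toContinuousLinearEquiv
  have hE : ∀ t, (((sumLin (L₁ t) (L₂ t)).symm.toContinuousLinearEquiv :
      ((σ₁ ⊕ σ₂) → ℝ) ≃L[ℝ] ((σ₁ ⊕ σ₂) → ℝ)) : ((σ₁ ⊕ σ₂) → ℝ) →L[ℝ] ((σ₁ ⊕ σ₂) → ℝ)) =
      ((E.symm : (σ₁ → ℝ) × (σ₂ → ℝ) →L[ℝ] ((σ₁ ⊕ σ₂) → ℝ)).comp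
        (((((L₁ t).symm.toContinuousLinearEquiv : (σ₁ → ℝ) ≃L[ℝ] (σ₁ → ℝ)) :
            (σ₁ → ℝ) →L[ℝ] (σ₁ → ℝ)).prodMap
          (((L₂ t).symm.toContinuousLinearEquiv : (σ₂ → ℝ) ≃L[ℝ] (σ₂ → ℝ)) :
            (σ₂ → ℝ) →L[ℝ] (σ₂ → ℝ))).comp
          (E : ((σ₁ ⊕ σ₂) → ℝ) →L[ℝ] (σ₁ → ℝ) × (σ₂ → ℝ)))) := by
    intro t
    ext x i
    rcases i with i | j
    · rfl
    · rfl
  simp only [hE]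
  exact continuous_const.clm_comp
    (((ContinuousLinearMap.prodMapL ℝ (σ₁ → ℝ) (σ₁ → ℝ) (σ₂ → ℝ) (σ₂ → ℝ)).continuous.comp
      (h₁.prodMk h₂)).clm_comp continuous_const)

end Blocks

/-! ## 2. Product word maps -/

section Word

variable {G₁ G₂ : Type*} [Monoid G₁] [Monoid G₂] [TopologicalSpace G₁] [TopologicalSpace G₂]
  {K₁ K₂ P₁ P₂ : Type*} [TopologicalSpace K₁] [TopologicalSpace K₂] [TopologicalSpace P₁] [TopologicalSpace P₂]

/-- The shuffle `((k₁,k₂),(t₁,t₂),(k₁',k₂')) ↦ ((k₁,t₁,k₁'),(k₂,t₂,k₂'))`. [folklore] -/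
def wordShuffle (K₁ K₂ P₁ P₂ : Type*) [TopologicalSpace K₁] [TopologicalSpace K₂] [TopologicalSpace P₁]
    [TopologicalSpace P₂] :
    (K₁ × K₂) × (P₁ × P₂) × (K₁ × K₂) ≃ₜ (K₁ × P₁ × K₁) × (K₂ × P₂ × K₂) where
  toFun x := ((x.1.1, x.2.1.1, x.2.2.1), (x.1.2, x.2.1.2, x.2.2.2))
  invFun y := ((y.1.1, y.2.1), (y.1.2.1, y.2.2.1), (y.1.2.2, y.2.2.2))
  left_inv _ := rfl
  right_inv _ := rfl
  continuous_toFun := by fun_prop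
  continuous_invFun := by fun_prop

omit [TopologicalSpace G₁] [TopologicalSpace G₂] in
/-- The word map of the product is the product of the word maps, up to the shuffle. [folklore] -/
theorem word_prod_eq (κ₁ : K₁ → G₁) (a₁ : P₁ → G₁) (κ₂ : K₂ → G₂) (a₂ : P₂ → G₂) :
    (fun p : (K₁ × K₂) × (P₁ × P₂) × (K₁ × K₂) =>
        ((κ₁ p.1.1, κ₂ p.1.2) : G₁ × G₂) * (a₁ p.2.1.1, a₂ p.2.1.2) * (κ₁ p.2.2.1, κ₂ p.2.2.2)) =
      Prod.map (fun p : K₁ × P₁ × K₁ => κ₁ p.1 * a₁ p.2.1 * κ₁ p.2.2)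
          (fun p : K₂ × P₂ × K₂ => κ₂ p.1 * a₂ p.2.1 * κ₂ p.2.2) ∘
        wordShuffle K₁ K₂ P₁ P₂ := by
  funext p
  rfl

/-- **Properness of the product word map.** [cite: Knapp2002, Thm 7.39] -/
theorem isProperMap_word_prod {κ₁ : K₁ → G₁} {a₁ : P₁ → G₁} {κ₂ : K₂ → G₂} {a₂ : P₂ → G₂}
    (h₁ : IsProperMap fun p : K₁ × P₁ × K₁ => κ₁ p.1 * a₁ p.2.1 * κ₁ p.2.2)
    (h₂ : IsProperMap fun p : K₂ × P₂ × K₂ => κ₂ p.1 * a₂ p.2.1 * κ₂ p.2.2) :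
    IsProperMap fun p : (K₁ × K₂) × (P₁ × P₂) × (K₁ × K₂) =>
      ((κ₁ p.1.1, κ₂ p.1.2) : G₁ × G₂) * (a₁ p.2.1.1, a₂ p.2.1.2) * (κ₁ p.2.2.1, κ₂ p.2.2.2) := by
  rw [word_prod_eq]
  exact (h₁.prodMap h₂).comp (wordShuffle K₁ K₂ P₁ P₂).isProperMap

omit [TopologicalSpace G₁] [TopologicalSpace G₂] in
/-- **Surjectivity of the product word map.** [cite: Knapp2002, Thm 7.39] -/
theorem surjective_word_prod {κ₁ : K₁ → G₁} {a₁ : P₁ → G₁} {κ₂ : K₂ → G₂} {a₂ : P₂ → G₂}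
    (h₁ : Function.Surjective fun p : K₁ × P₁ × K₁ => κ₁ p.1 * a₁ p.2.1 * κ₁ p.2.2)
    (h₂ : Function.Surjective fun p : K₂ × P₂ × K₂ => κ₂ p.1 * a₂ p.2.1 * κ₂ p.2.2) :
    Function.Surjective fun p : (K₁ × K₂) × (P₁ × P₂) × (K₁ × K₂) =>
      ((κ₁ p.1.1, κ₂ p.1.2) : G₁ × G₂) * (a₁ p.2.1.1, a₂ p.2.1.2) * (κ₁ p.2.2.1, κ₂ p.2.2.2) := by
  rw [word_prod_eq]
  exact (h₁.prodMap h₂).comp (wordShuffle K₁ K₂ P₁ P₂).surjective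

end Word

/-! ## 3. The product constructor -/

section Prod

variable {G₁ G₂ : Type*} [Monoid G₁] [Monoid G₂] [TopologicalSpace G₁] [TopologicalSpace G₂]
  {K₁ K₂ P₁ P₂ : Type*} [TopologicalSpace K₁] [TopologicalSpace K₂] [TopologicalSpace P₁] [TopologicalSpace P₂]

/-- **`KAK` implementer data of a product `G₁ × G₂` on `𝓢(ℝ^{σ₁ ⊕ σ₂})` from Levi-family inputs of the
factors.** [cite: Folland1989, §4.2 (4.24), Prop. (4.39); Knapp2002, Thm 7.39] -/
theorem kakImplementerData_leviFamily_prod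
    {γ₁ : G₁ → PhaseMap σ₁} (hγ₁ : ∀ g g' pq, γ₁ (g * g') pq = γ₁ g (γ₁ g' pq))
    {κ₁ : K₁ → G₁} (ιK₁ : K₁ → Matrix.unitaryGroup σ₁ ℂ) (hιK₁ : Continuous ιK₁)
    (hreal₁ : ∀ k pq, γ₁ (κ₁ k) pq = realify (ιK₁ k) pq) {a₁ : P₁ → G₁} (U₁ : Matrix.unitaryGroup σ₁ ℂ)
    {L₁ Ld₁ : P₁ → ((σ₁ → ℝ) ≃ₗ[ℝ] (σ₁ → ℝ))} (had₁ : ∀ t (x y : σ₁ → ℝ), L₁ t x ⬝ᵥ Ld₁ t y = x ⬝ᵥ y)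
    (hL₁ : Continuous fun t => (((L₁ t).symm.toContinuousLinearEquiv : (σ₁ → ℝ) ≃L[ℝ] (σ₁ → ℝ)) :
      (σ₁ → ℝ) →L[ℝ] (σ₁ → ℝ)))
    (hγA₁ : ∀ t pq, γ₁ (a₁ t) pq = realify U₁⁻¹ (leviPhase (L₁ t) (Ld₁ t) (realify U₁ pq)))
    (hm₁ : IsProperMap fun p : K₁ × P₁ × K₁ => κ₁ p.1 * a₁ p.2.1 * κ₁ p.2.2)
    (hsurj₁ : Function.Surjective fun p : K₁ × P₁ × K₁ => κ₁ p.1 * a₁ p.2.1 * κ₁ p.2.2)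
    {γ₂ : G₂ → PhaseMap σ₂} (hγ₂ : ∀ g g' pq, γ₂ (g * g') pq = γ₂ g (γ₂ g' pq))
    {κ₂ : K₂ → G₂} (ιK₂ : K₂ → Matrix.unitaryGroup σ₂ ℂ) (hιK₂ : Continuous ιK₂)
    (hreal₂ : ∀ k pq, γ₂ (κ₂ k) pq = realify (ιK₂ k) pq) {a₂ : P₂ → G₂} (U₂ : Matrix.unitaryGroup σ₂ ℂ)
    {L₂ Ld₂ : P₂ → ((σ₂ → ℝ) ≃ₗ[ℝ] (σ₂ → ℝ))} (had₂ : ∀ t (x y : σ₂ → ℝ), L₂ t x ⬝ᵥ Ld₂ t y = x ⬝ᵥ y)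
    (hL₂ : Continuous fun t => (((L₂ t).symm.toContinuousLinearEquiv : (σ₂ → ℝ) ≃L[ℝ] (σ₂ → ℝ)) :
      (σ₂ → ℝ) →L[ℝ] (σ₂ → ℝ)))
    (hγA₂ : ∀ t pq, γ₂ (a₂ t) pq = realify U₂⁻¹ (leviPhase (L₂ t) (Ld₂ t) (realify U₂ pq)))
    (hm₂ : IsProperMap fun p : K₂ × P₂ × K₂ => κ₂ p.1 * a₂ p.2.1 * κ₂ p.2.2)
    (hsurj₂ : Function.Surjective fun p : K₂ × P₂ × K₂ => κ₂ p.1 * a₂ p.2.1 * κ₂ p.2.2) :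
    KAKImplementerData (fun g : G₁ × G₂ => sumPhase (γ₁ g.1) (γ₂ g.2))
      (fun k : K₁ × K₂ => ((κ₁ k.1, κ₂ k.2) : G₁ × G₂)) (fun t : P₁ × P₂ => ((a₁ t.1, a₂ t.2) : G₁ × G₂))
      (fun k => unitaryOpPi (blockU (ιK₁ k.1, ιK₂ k.2)))
      (fun t => (unitaryOpPi (blockU (U₁, U₂))⁻¹).comp
        ((leviS (sumLin (L₁ t.1) (L₂ t.2))).comp (unitaryOpPi (blockU (U₁, U₂))))) := by
  refine kakImplementerData_leviFamily (γ := fun g : G₁ × G₂ => sumPhase (γ₁ g.1) (γ₂ g.2))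
    (κ := fun k : K₁ × K₂ => ((κ₁ k.1, κ₂ k.2) : G₁ × G₂)) (a := fun t : P₁ × P₂ => ((a₁ t.1, a₂ t.2) : G₁ × G₂))
    (L := fun t : P₁ × P₂ => sumLin (L₁ t.1) (L₂ t.2)) (Ld := fun t : P₁ × P₂ => sumLin (Ld₁ t.1) (Ld₂ t.2))
    ?_ (fun k => blockU (ιK₁ k.1, ιK₂ k.2)) ?_ ?_ (blockU (U₁, U₂)) ?_ ?_ ?_ ?_ ?_
  · intro g g' pq
    have h1 : γ₁ (g.1 * g'.1) = γ₁ g.1 ∘ γ₁ g'.1 := funext (hγ₁ g.1 g'.1)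
    have h2 : γ₂ (g.2 * g'.2) = γ₂ g.2 ∘ γ₂ g'.2 := funext (hγ₂ g.2 g'.2)
    rw [Prod.fst_mul, Prod.snd_mul, h1, h2, sumPhase_comp]
    rfl
  · exact continuous_blockU.comp ((hιK₁.comp continuous_fst).prodMk (hιK₂.comp continuous_snd))
  · intro k pq
    have h1 : γ₁ (κ₁ k.1) = realify (ιK₁ k.1) := funext (hreal₁ k.1)
    have h2 : γ₂ (κ₂ k.2) = realify (ιK₂ k.2) := funext (hreal₂ k.2)
    simp only [h1, h2, realify_blockU]
  · exact fun t x y => sumLin_dotProduct (had₁ t.1) (had₂ t.2) x y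
  · exact continuous_sumLin_symm (hL₁.comp continuous_fst) (hL₂.comp continuous_snd)
  · intro t pq
    have h1 : γ₁ (a₁ t.1) = realify U₁⁻¹ ∘ leviPhase (L₁ t.1) (Ld₁ t.1) ∘ realify U₁ := funext (hγA₁ t.1)
    have h2 : γ₂ (a₂ t.2) = realify U₂⁻¹ ∘ leviPhase (L₂ t.2) (Ld₂ t.2) ∘ realify U₂ := funext (hγA₂ t.2)
    have hinv : (blockU (U₁, U₂))⁻¹ = blockU (U₁⁻¹, U₂⁻¹) := by rw [← map_inv]; rfl
    simp only [h1, h2, hinv, realify_blockU, leviPhase_sumLin, sumPhase_comp, Function.comp_apply]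
  · exact isProperMap_word_prod hm₁ hm₂
  · exact surjective_word_prod hsurj₁ hsurj₂

/-- **… with a COMPACT second factor** (`G₂ = κ₂(K₂) · κ₂(K₂)`, trivial `A`-part): the dilation family is
`sumLin (L₁ t) 1` in the frame `blockU (U₁, 1)`. [cite: Folland1989, Prop. (4.39); Knapp2002, Thm 7.39] -/
theorem kakImplementerData_leviFamily_prod_compact [CompactSpace K₂] [T2Space G₂] [ContinuousMul G₂]
    {γ₁ : G₁ → PhaseMap σ₁} (hγ₁ : ∀ g g' pq, γ₁ (g * g') pq = γ₁ g (γ₁ g' pq))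
    {κ₁ : K₁ → G₁} (ιK₁ : K₁ → Matrix.unitaryGroup σ₁ ℂ) (hιK₁ : Continuous ιK₁)
    (hreal₁ : ∀ k pq, γ₁ (κ₁ k) pq = realify (ιK₁ k) pq) {a₁ : P₁ → G₁} (U₁ : Matrix.unitaryGroup σ₁ ℂ)
    {L₁ Ld₁ : P₁ → ((σ₁ → ℝ) ≃ₗ[ℝ] (σ₁ → ℝ))} (had₁ : ∀ t (x y : σ₁ → ℝ), L₁ t x ⬝ᵥ Ld₁ t y = x ⬝ᵥ y)
    (hL₁ : Continuous fun t => (((L₁ t).symm.toContinuousLinearEquiv : (σ₁ → ℝ) ≃L[ℝ] (σ₁ → ℝ)) :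
      (σ₁ → ℝ) →L[ℝ] (σ₁ → ℝ)))
    (hγA₁ : ∀ t pq, γ₁ (a₁ t) pq = realify U₁⁻¹ (leviPhase (L₁ t) (Ld₁ t) (realify U₁ pq)))
    (hm₁ : IsProperMap fun p : K₁ × P₁ × K₁ => κ₁ p.1 * a₁ p.2.1 * κ₁ p.2.2)
    (hsurj₁ : Function.Surjective fun p : K₁ × P₁ × K₁ => κ₁ p.1 * a₁ p.2.1 * κ₁ p.2.2)
    {γ₂ : G₂ → PhaseMap σ₂} (hγ₂ : ∀ g g' pq, γ₂ (g * g') pq = γ₂ g (γ₂ g' pq)) (hone₂ : ∀ pq, γ₂ 1 pq = pq)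
    {κ₂ : K₂ → G₂} (hκ₂ : Continuous κ₂) (ιK₂ : K₂ → Matrix.unitaryGroup σ₂ ℂ) (hιK₂ : Continuous ιK₂)
    (hreal₂ : ∀ k pq, γ₂ (κ₂ k) pq = realify (ιK₂ k) pq) (hsurj₂ : ∀ g : G₂, ∃ k₁ k₂ : K₂, κ₂ k₁ * κ₂ k₂ = g) :
    KAKImplementerData (fun g : G₁ × G₂ => sumPhase (γ₁ g.1) (γ₂ g.2))
      (fun k : K₁ × K₂ => ((κ₁ k.1, κ₂ k.2) : G₁ × G₂))
      (fun t : P₁ × PUnit => ((a₁ t.1, (1 : G₂)) : G₁ × G₂))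
      (fun k => unitaryOpPi (blockU (ιK₁ k.1, ιK₂ k.2)))
      (fun t => (unitaryOpPi (blockU (U₁, (1 : Matrix.unitaryGroup σ₂ ℂ)))⁻¹).comp
        ((leviS (sumLin (L₁ t.1) (LinearEquiv.refl ℝ (σ₂ → ℝ)))).comp
          (unitaryOpPi (blockU (U₁, (1 : Matrix.unitaryGroup σ₂ ℂ)))))) := by
  refine kakImplementerData_leviFamily_prod hγ₁ ιK₁ hιK₁ hreal₁ U₁ had₁ hL₁ hγA₁ hm₁ hsurj₁ hγ₂ ιK₂ hιK₂ hreal₂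
    (a₂ := fun _ : PUnit => (1 : G₂)) 1 (L₂ := fun _ => LinearEquiv.refl ℝ (σ₂ → ℝ))
    (Ld₂ := fun _ => LinearEquiv.refl ℝ (σ₂ → ℝ)) (fun _ _ _ => rfl) continuous_const ?_ ?_ ?_
  · intro _ pq
    rw [hone₂, inv_one, realify_one, leviPhase_apply, LinearEquiv.refl_apply, LinearEquiv.refl_apply,
      Prod.mk.eta, realify_one]
  · exact Continuous.isProperMap (by fun_prop)
  · intro g
    obtain ⟨k₁, k₂, h⟩ := hsurj₂ g
    exact ⟨(k₁, PUnit.unit, k₂), by simpa only [mul_one] using h⟩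

end Prod

end Literature.RepresentationTheory.KonnoKonno2007

end
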